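import Literature.NumberTheory.Automorphic.LieGraphCore
import HarnessLib

/-!
# The Lie-algebra isomorphism theorem, III: the symmetry `(G₁, G₂) ↔ (G₂, G₁)` of the graph subalgebra
(trunk T-AUTOMORPHIC, G25 AutomorphicL; Humphreys 14.2; DAG of `chevalley_isomorphism`)

`LieGraphCore.lean` proved `(0, e²_γ) ∉ D` for the graph subalgebra `D = graphSubalgebra hT₁ hT₂ h₁ h₂ y`
of `𝔤𝔩_{n₁} × 𝔤𝔩_{n₂}`. Swapping the factors carries `D` into the graph subalgebra of the swapped data
(`swap_mem_graphSubalgebra`: the generators go to generators, the graph of `θ` to the graph of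
`θ⁻¹ = theta eX₂ eX₁`, `theta_symm_eq`), so the same theorem for `(G₂, G₁)` gives
**`not_inl_rootE_mem`: `(e¹_γ, 0) ∉ D`**. Recorded on the way: the swap Lie homomorphism `swapHom`,
`theta_theta` (`θ₂₁ ∘ θ₁₂ = id`).

## References

* [Humphreys1972] J. E. Humphreys, *Introduction to Lie Algebras and Representation Theory*,
  GTM 9, Springer (1972), §14.2.
-/

noncomputable section

open scoped MatrixGroups IsMulCommutative
open Set

attribute [local instance 100] LieRing.ofAssociativeRing

namespace Literature.NumberTheory.Automorphic

namespace LieGraph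

variable {k : Type*} [Field k]
variable {n₁ n₂ : Type*} [Fintype n₁] [DecidableEq n₁] [Fintype n₂] [DecidableEq n₂]
variable {ι X Y : Type*} [AddCommGroup X] [AddCommGroup Y]
variable {G₁ T₁ : Subgroup (GL n₁ k)} {G₂ T₂ : Subgroup (GL n₂ k)}
  [IsMulCommutative ↥T₁] [IsMulCommutative ↥T₂]
variable {P : RootPairing ι ℤ X Y}
variable {eX₁ : Additive ↥(characterLattice T₁) ≃+ X} {eY₁ : Additive ↥(cocharacterLattice T₁) ≃+ Y}
variable {eX₂ : Additive ↥(characterLattice T₂) ≃+ X} {eY₂ : Additive ↥(cocharacterLattice T₂) ≃+ Y}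

/-! ### The swap homomorphism -/

omit [IsMulCommutative ↥T₁] [IsMulCommutative ↥T₂] in
variable (k n₁ n₂) in
/-- The swap `𝔤𝔩_{n₁} × 𝔤𝔩_{n₂} → 𝔤𝔩_{n₂} × 𝔤𝔩_{n₁}` as a homomorphism of Lie algebras. [folklore] -/
def swapHom : (Matrix n₁ n₁ k × Matrix n₂ n₂ k) →ₗ⁅k⁆ (Matrix n₂ n₂ k × Matrix n₁ n₁ k) where
  toLinearMap := (LinearEquiv.prodComm k (Matrix n₁ n₁ k) (Matrix n₂ n₂ k)).toLinearMap
  map_lie' := by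
    intro A B
    change (⁅A, B⁆ : Matrix n₁ n₁ k × Matrix n₂ n₂ k).swap = ⁅A.swap, B.swap⁆
    rw [bracket_eq, bracket_eq]
    rfl

omit [IsMulCommutative ↥T₁] [IsMulCommutative ↥T₂] in
/-- Unfolding of `swapHom`. [folklore] -/
@[simp] lemma swapHom_apply (A : Matrix n₁ n₁ k × Matrix n₂ n₂ k) : swapHom k n₁ n₂ A = A.swap := rfl

/-! ### `θ₂₁ = θ₁₂⁻¹` -/

section Theta

variable [IsAlgClosed k] (hT₁ : IsTorusSubgroup T₁) (hT₂ : IsTorusSubgroup T₂)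

omit [IsMulCommutative ↥T₁] [IsMulCommutative ↥T₂] in
/-- **`θ₂₁ (θ₁₂ H) = H`**: the identification for the swapped data inverts `θ`. [folklore] -/
theorem theta_theta (H : ↥(lieAlgebraGL T₁)) :
    theta eX₂ eX₁ hT₂ hT₁ (theta eX₁ eX₂ hT₁ hT₂ H) = H := by
  apply (lieTorusDual_bijective hT₁).1
  refine AddMonoidHom.ext fun a => ?_
  rw [lieTorusDual_apply, lieTorusDual_apply]
  obtain ⟨x, rfl⟩ : ∃ x : X, eX₁.symm x = a := ⟨eX₁ a, eX₁.symm_apply_apply a⟩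
  exact (dChar_theta eX₂ eX₁ hT₂ hT₁ _ x).trans (dChar_theta eX₁ eX₂ hT₁ hT₂ H x)

omit [IsMulCommutative ↥T₁] [IsMulCommutative ↥T₂] in
/-- **`θ₂₁ = θ₁₂⁻¹`.** [folklore] -/
theorem theta_symm_eq (H₂ : ↥(lieAlgebraGL T₂)) :
    theta eX₂ eX₁ hT₂ hT₁ H₂ = (theta eX₁ eX₂ hT₁ hT₂).symm H₂ := by
  have h := theta_theta (eX₁ := eX₁) (eX₂ := eX₂) hT₁ hT₂ ((theta eX₁ eX₂ hT₁ hT₂).symm H₂)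
  rwa [LinearEquiv.apply_symm_apply] at h

end Theta

/-! ### Swapping the graph subalgebra -/

section Swap

variable [IsAlgClosed k] [CharZero k] [Finite ι]
variable (hG₁ : IsConnectedReductive G₁) (hT₁ : IsMaximalTorusIn T₁ G₁)
  (hG₂ : IsConnectedReductive G₂) (hT₂ : IsMaximalTorusIn T₂ G₂)
  (h₁ : IsRootDatumOf G₁ T₁ P eX₁ eY₁) (h₂ : IsRootDatumOf G₂ T₂ P eX₂ eY₂)

omit [CharZero k] [Finite ι] in
/-- **The swap carries `D(G₁, G₂)` into `D(G₂, G₁)`** (generators to generators, the graph of `θ` to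
the graph of `θ⁻¹`). [cite: Humphreys1972, 14.2] -/
theorem swap_mem_graphSubalgebra (y : Y) {A : Matrix n₁ n₁ k × Matrix n₂ n₂ k}
    (hA : A ∈ graphSubalgebra hT₁ hT₂ h₁ h₂ y) : A.swap ∈ graphSubalgebra hT₂ hT₁ h₂ h₁ y := by
  suffices hle : graphSubalgebra hT₁ hT₂ h₁ h₂ y ≤ (graphSubalgebra hT₂ hT₁ h₂ h₁ y).comap (swapHom k n₁ n₂) from
    hle hA
  rw [graphSubalgebra, LieSubalgebra.lieSpan_le]
  intro s hs
  rw [SetLike.mem_coe, LieSubalgebra.mem_comap, swapHom_apply]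
  rcases hs with ((⟨i, hi, rfl⟩ | ⟨i, hi, rfl⟩) | ⟨H, rfl⟩)
  · exact rootE_pair_mem hi
  · exact rootF_pair_mem hi
  · -- `(θ H, H) = (H₂, θ⁻¹ H₂)` with `H₂ = θ H`
    have hgr := graph_mem (hT₁ := hT₂) (hT₂ := hT₁) (h₁ := h₂) (h₂ := h₁) y (theta eX₁ eX₂ hT₁.2.1 hT₂.2.1 H)
    rw [theta_theta] at hgr
    exact hgr

include hG₁ hT₁ hG₂ hT₂ in
/-- **`(e¹_γ, 0) ∉ D` for every root `α_γ`** (`not_inr_rootE_mem` for the swapped data).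
[cite: Humphreys1972, 14.2] -/
theorem not_inl_rootE_mem {y : Y} (hy : ∀ i, P.root' i y ≠ 0) (γ : ι) :
    ((h₁.rootE γ, (0 : Matrix n₂ n₂ k)) : Matrix n₁ n₁ k × Matrix n₂ n₂ k) ∉ graphSubalgebra hT₁ hT₂ h₁ h₂ y := by
  intro hmem
  have hsw := swap_mem_graphSubalgebra hT₁ hT₂ h₁ h₂ y hmem
  exact not_inr_rootE_mem hG₂ hT₂ hG₁ hT₁ h₂ h₁ hy γ hsw

end Swap

end LieGraph

end Literature.NumberTheory.Automorphic
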